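import Summits.Ventures.HodgeRepro2.T5HermitianGlobalChain

/-!
# The set `D` of the chain in the vocabulary of the dyadic census: primes over `2ℤ`, one prime above — and when
`|D| ≤ 1` holds (cell pub-hodge-repro2, seat p3)

Tier-5 N2 support, rows N2.8.1 (ii)/(iv) and N2.2.5 of route/T5-N2-route-3.md. File 156's chain takes the input
`hD : (dyadicNonSplit K θ).Subsingleton` («`|D| ≤ 1`», `D` = the dyadic places of `K⁺` non-split in `K`) with
`dyadicNonSplit K θ := {v | ¬ IsUnit (2 : O_{K⁺_v}) ∧ ¬ IsSquare θ_v}`. This seat's dyadic census (files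
T5DyadicPlaces / T5ResidualShape / T5DyadicOrbit: `|D| ∈ {0, 1, 3}`, `D = ∅` iff `2` splits in the quadratic subfield)
speaks of the primes of `𝓞 K⁺` over `2ℤ` and of the number of primes of `𝓞 K` above them. This file identifies the
two readings and gives the kernel sufficient conditions for `hD`:

* `isUnit_two_iff`: `2` is a unit of `O_{F_v}` iff `2 ∉ v` (the valuation of `2` at `v`);
* `two_mem_iff_liesOver`: `2 ∈ v` iff `v` lies over `2ℤ`;
* **`mem_dyadicNonSplit_iff`**: `v ∈ D` iff `v` lies over `2ℤ` and has exactly ONE prime of `K` above it;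
* **`dyadicNonSplit_subsingleton_of_ncard_le_one`**: at most one prime of `K⁺` over `2` (`2` inert or ramified in
  `K⁺`, i.e. `g₂ = 1`) ⇒ `|D| ≤ 1`;
* **`dyadicNonSplit_eq_empty_of_split`** / `dyadicNonSplit_subsingleton_of_split`: every dyadic place splits in
  `K` ⇒ `D = ∅` (the case «`2` splits in the quadratic subfield», row N2.2.5);
* `dyadicNonSplit_K7_eq_empty`: on the field of record `ℚ(ζ₇)`, `D = ∅` (file 145).

Mathlib + this seat's files 126 / 128 / 145 / 154 / 156 and their imports; no display; no device.
§8(d): uses an L-value-free non-vanishing device: NO.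
-/

namespace Summit.Ventures.HodgeRepro2.T5DyadicNonSplit

open IsDedekindDomain IsDedekindDomain.HeightOneSpectrum NumberField NumberField.IsCMField
open Summit.Ventures.HodgeRepro2.T5HermitianGlobalChain Summit.Ventures.HodgeRepro2.T5FinitePlaceSplitIff
  Summit.Ventures.HodgeRepro2.T5FinitePlaceExistsOver

section Two

variable {F : Type*} [Field F] [NumberField F] (v : HeightOneSpectrum (𝓞 F))

/-- **`2` is a unit of `O_{F_v}` iff `2 ∉ v`** (the valuation of `2` at `v` is `1` iff `2 ∉ v`). -/
theorem isUnit_two_iff : IsUnit (2 : adicCompletionIntegers F v) ↔ (2 : 𝓞 F) ∉ v.asIdeal := by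
  rw [adicCompletionIntegers.isUnit_iff_valued_eq_one, ← valuation_eq_one_iff_notMem (K := F) v,
    ← valuedAdicCompletion_eq_valuation]
  change Valued.v (2 : v.adicCompletion F) = 1 ↔ Valued.v (algebraMap (𝓞 F) (v.adicCompletion F) 2) = 1
  rw [map_ofNat (algebraMap (𝓞 F) (v.adicCompletion F)) 2]

/-- A prime ideal of `ℤ` containing `2` is `2ℤ`. -/
theorem eq_span_two_of_mem (P : Ideal ℤ) [P.IsPrime] (h : (2 : ℤ) ∈ P) : P = Ideal.span {(2 : ℤ)} :=
  ((PrincipalIdealRing.isMaximal_of_irreducible Int.prime_two.irreducible).eq_of_le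
    ‹P.IsPrime›.ne_top ((Ideal.span_singleton_le_iff_mem P).mpr h)).symm

omit [NumberField F] in
/-- **`2 ∈ v` iff `v` lies over `2ℤ`.** -/
theorem two_mem_iff_liesOver : (2 : 𝓞 F) ∈ v.asIdeal ↔ v.asIdeal.LiesOver (Ideal.span {(2 : ℤ)}) := by
  constructor
  · intro h
    have hmem : (2 : ℤ) ∈ v.asIdeal.under ℤ := by
      rw [Ideal.mem_under, map_ofNat]
      exact h
    exact ⟨(eq_span_two_of_mem _ hmem).symm⟩
  · intro h
    haveI := h
    have := (Ideal.mem_of_liesOver v.asIdeal (Ideal.span {(2 : ℤ)}) (2 : ℤ)).mp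
      (Ideal.mem_span_singleton_self 2)
    rwa [map_ofNat] at this

end Two

section Census

variable (K : Type*) [Field K] [NumberField K] [IsCMField K]
variable {θ : maximalRealSubfield K} {y : K}
  (hθ : algebraMap (maximalRealSubfield K) K θ = y ^ 2) (hy : complexConj K y ≠ y)

include hθ hy in
/-- **`D` in the census vocabulary:** `v ∈ D` iff `v` lies over `2ℤ` and has exactly one prime of `K` above it
(file 126: non-split ⟺ `θ` not a `v`-adic square). -/
theorem mem_dyadicNonSplit_iff (v : HeightOneSpectrum (𝓞 (maximalRealSubfield K))) :
    v ∈ dyadicNonSplit K (θ := θ) ↔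
      v.asIdeal.LiesOver (Ideal.span {(2 : ℤ)}) ∧ (v.asIdeal.primesOver (𝓞 K)).ncard = 1 := by
  obtain ⟨w, hw⟩ := exists_liesOver K v
  show (¬ IsUnit (2 : adicCompletionIntegers (maximalRealSubfield K) v) ∧
    ¬ IsSquare (algebraMap (maximalRealSubfield K) (v.adicCompletion (maximalRealSubfield K)) θ)) ↔ _
  rw [isUnit_two_iff, not_not, two_mem_iff_liesOver, ← ncard_primesOver_eq_one_iff_not_isSquare K v w hθ hy]

include hθ hy in
/-- **At most one prime of `K⁺` over `2` ⇒ `|D| ≤ 1`** (`2` inert or ramified in `K⁺`, `g₂ = 1`). -/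
theorem dyadicNonSplit_subsingleton_of_ncard_le_one
    (h : ((Ideal.span {(2 : ℤ)}).primesOver (𝓞 (maximalRealSubfield K))).ncard ≤ 1) :
    (dyadicNonSplit K (θ := θ)).Subsingleton := by
  intro v hv v' hv'
  rw [mem_dyadicNonSplit_iff K hθ hy] at hv hv'
  haveI : (Ideal.span {(2 : ℤ)}).IsMaximal :=
    PrincipalIdealRing.isMaximal_of_irreducible Int.prime_two.irreducible
  have hfin : ((Ideal.span {(2 : ℤ)}).primesOver (𝓞 (maximalRealSubfield K))).Finite :=
    IsDedekindDomain.primesOver_finite _ _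
  have hmem : v.asIdeal ∈ (Ideal.span {(2 : ℤ)}).primesOver (𝓞 (maximalRealSubfield K)) := ⟨v.isPrime, hv.1⟩
  have hmem' : v'.asIdeal ∈ (Ideal.span {(2 : ℤ)}).primesOver (𝓞 (maximalRealSubfield K)) := ⟨v'.isPrime, hv'.1⟩
  exact HeightOneSpectrum.ext ((Set.ncard_le_one hfin).mp h _ hmem _ hmem')

include hθ hy in
/-- **Every dyadic place splits in `K` ⇒ `D = ∅`** (row N2.2.5: `2` splits in the quadratic subfield). -/
theorem dyadicNonSplit_eq_empty_of_split
    (h : ∀ v : HeightOneSpectrum (𝓞 (maximalRealSubfield K)), v.asIdeal.LiesOver (Ideal.span {(2 : ℤ)}) →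
      (v.asIdeal.primesOver (𝓞 K)).ncard = 2) :
    dyadicNonSplit K (θ := θ) = ∅ := by
  ext v
  simp only [Set.mem_empty_iff_false, iff_false]
  intro hv
  rw [mem_dyadicNonSplit_iff K hθ hy] at hv
  have := h v hv.1
  omega

include hθ hy in
/-- Every dyadic place splits in `K` ⇒ `|D| ≤ 1` (indeed `D = ∅`). -/
theorem dyadicNonSplit_subsingleton_of_split
    (h : ∀ v : HeightOneSpectrum (𝓞 (maximalRealSubfield K)), v.asIdeal.LiesOver (Ideal.span {(2 : ℤ)}) →
      (v.asIdeal.primesOver (𝓞 K)).ncard = 2) :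
    (dyadicNonSplit K (θ := θ)).Subsingleton := by
  rw [dyadicNonSplit_eq_empty_of_split K hθ hy h]
  exact Set.subsingleton_empty

end Census

section FieldOfRecord

open Summit.Ventures.HodgeRepro2.CyclotomicSeven Summit.Ventures.HodgeRepro2.T5CyclotomicSevenNonDyadic
  Summit.Ventures.HodgeRepro2.T5CyclotomicSevenClassification

/-- **On `ℚ(ζ₇)`, `D = ∅`:** the dyadic place of `ℚ(ζ₇)⁺` splits in `ℚ(ζ₇)` (file 145). -/
theorem dyadicNonSplit_K7_eq_empty : dyadicNonSplit K7 (θ := (-7 : maximalRealSubfield K7)) = ∅ := by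
  ext v
  simp only [Set.mem_empty_iff_false, iff_false]
  rintro ⟨h2, hsq⟩
  exact h2 (isUnit_two_of_not_isSquare v algebraMap_neg_seven.symm hsq)

/-- On `ℚ(ζ₇)`, `|D| ≤ 1` (file 156's `hD`, for the datum `(−7, √−7)`). -/
theorem dyadicNonSplit_K7_subsingleton : (dyadicNonSplit K7 (θ := (-7 : maximalRealSubfield K7))).Subsingleton := by
  rw [dyadicNonSplit_K7_eq_empty]
  exact Set.subsingleton_empty

end FieldOfRecord

end Summit.Ventures.HodgeRepro2.T5DyadicNonSplit
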